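import Mathlib
import Summits.Ventures.PercRepro2.Defs
import Summits.Ventures.PercRepro2.Graph
import Summits.Ventures.PercRepro2.OneColourSwitch
import Summits.Ventures.PercRepro2.RegionHubSign
import Summits.Ventures.PercRepro2.SideSwitch
import Summits.Ventures.PercRepro2.M9NoPocketDefs
import Summits.Ventures.PercRepro2.M9NoPocketM9
import Summits.Ventures.PercRepro2.M9DAvoid
import Summits.Ventures.PercRepro2.M9DAvoidSplit
import Summits.Ventures.PercRepro2.M9Trichotomy
import Summits.Ventures.PercRepro2.M9SOneHarris
import Summits.Ventures.PercRepro2.M9EdgeTransfer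
import Summits.Ventures.PercRepro2.M9GammaEval
import Summits.Ventures.PercRepro2.M9GammaBase
import Summits.Ventures.PercRepro2.M9GammaSum

/-!
# Conjecture G: the single-`d` sign sum is non-positive on every finite multigraph with edges
`d–r` and `d–s` (blind cell PercRepro2, p3 g24, 2026-08-28; `proofs/P3-CONJG.md` §5)

`dSignSum = dSignSumAvoid − 2·eWSum` (g22), `dSignSumAvoid = 2·sOneSum + gammaSum`
(`M9Trichotomy`), `sOneSum ≤ 0` (a down-set of the pocket cube, `M9SOneHarris`), `gammaSum ≤ 0`
(twice a restricted terminal-set sum of the looped graph, `M9GammaSum`) and `eWSum ≥ 0` (g22):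
`dSignSum ≤ 0` (`dSignSum_nonpos_of_edges`), with no hypothesis on the other edges — the
hypothesis-(i)-free generalisation of the no-pocket theorem (g20) and of the class theorem with a
pocket (g23).  Corollary: `m9 ≤ 0` whenever every `Sep`-colouring is doubly reached only at `d`
(`m9SignSum_nonpos_of_dOne`).  Own work; std axioms.
-/

namespace Summit.Ventures.PercRepro2

namespace NoPocket

open Finset Classical RegionHub OneColourSwitch SideSwitch

variable {V : Type*} {E : Type*}

section Main

variable [Fintype V] [DecidableEq V] [Fintype E] [DecidableEq E] {ends : E → Sym2 V}

omit [Fintype V] [DecidableEq V] in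
/-- With `r = s` the pair `{r, s}` has `σ_rs = 0`, so the single-`d` sum vanishes. -/
lemma dSignSum_eq_zero_of_eq (p q r d : V) : dSignSum ends p q r r d = 0 := by
  unfold dSignSum
  refine Finset.sum_eq_zero fun ω _ => ?_
  have h : sigma ends ω r r = 0 := by
    simp [sigma, conn_refl]
  rw [h, mul_zero, ite_self]

omit [Fintype V] [DecidableEq V] [Fintype E] [DecidableEq E] in
/-- Two edges `d–r` and `d–s` with `r ≠ s`, `d ≠ s` are distinct. -/
lemma ne_of_edges {r s d : V} (hs : d ≠ s) (hrs : r ≠ s) {er es : E} (her : ends er = s(d, r))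
    (hes : ends es = s(d, s)) : er ≠ es := by
  rintro rfl
  rw [her, Sym2.eq_iff] at hes
  rcases hes with ⟨_, h⟩ | ⟨h, _⟩
  · exact hrs h
  · exact hs h

/-- **CONJECTURE G**: on every finite multigraph with an edge `d–r` and an edge `d–s`
(`p, q, r, s ≠ d`), `Σ_{Sep, D(ω) ⊆ {d}} σ_pq · σ_rs ≤ 0`. -/
theorem dSignSum_nonpos_of_edges {p q r s d : V} (hr : d ≠ r) (hs : d ≠ s) (hpd : p ≠ d)
    (hqd : q ≠ d) {er es : E} (her : ends er = s(d, r)) (hes : ends es = s(d, s)) :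
    dSignSum ends p q r s d ≤ 0 := by
  by_cases hrs : r = s
  · subst hrs
    rw [dSignSum_eq_zero_of_eq]
  · have hne : er ≠ es := ne_of_edges hs hrs her hes
    rw [dSignSum_eq_avoid_sub, dSignSumAvoid_eq_two_sOne_add_gamma p q r s d her hes]
    have h1 := sOneSum_nonpos hr hs hpd hqd her
    have h2 := gammaSum_nonpos (p := p) (q := q) her hes hne
    have h3 := eWSum_nonneg_of_edges p q r s d her hes
    linarith

/-- **`m9 ≤ 0` on the single-`d` family**: if every `Sep`-colouring is doubly reached only at
`d`, and `d` is adjacent to `r` and to `s`, then `Σ_{Sep} σ_pq · σ_rs ≤ 0`. -/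
theorem m9SignSum_nonpos_of_dOne {p q r s d : V}
    (hD : ∀ ω, sep2 ends p q r s ω → DOne ends r s d ω)
    (hr : d ≠ r) (hs : d ≠ s) (hpd : p ≠ d) (hqd : q ≠ d) {er es : E} (her : ends er = s(d, r))
    (hes : ends es = s(d, s)) : m9SignSum ends p q r s ≤ 0 := by
  have h : m9SignSum ends p q r s = dSignSum ends p q r s d := by
    unfold m9SignSum dSignSum
    refine Finset.sum_congr rfl (fun ω _ => ?_)
    by_cases hsep : sep2 ends p q r s ω
    · simp [hsep, hD ω hsep]
    · simp [hsep]
  rw [h]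
  exact dSignSum_nonpos_of_edges hr hs hpd hqd her hes

/-- **The class theorem with a pocket, without its hypothesis (i) on the `p, q`-side**: if every
non-mark other than `d` is adjacent to `p` or `q` — used only to make every `Sep`-colouring
doubly reached only at `d` — and `d` is adjacent to `r` and `s`, then `m9 ≤ 0`; re-derived from
Conjecture G. -/
theorem m9SignSum_nonpos_of_adj_d {p q r s d : V}
    (hadj : ∀ x, Nonmark p q r s x → x ≠ d → ∃ e, ends e = s(x, p) ∨ ends e = s(x, q))
    (hpd : p ≠ d) (hqd : q ≠ d) (hr : d ≠ r) (hs : d ≠ s) {er es : E} (her : ends er = s(d, r))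
    (hes : ends es = s(d, s)) : m9SignSum ends p q r s ≤ 0 :=
  m9SignSum_nonpos_of_dOne (fun _ hsep => DOne_of_adj hadj hsep) hr hs hpd hqd her hes

end Main

end NoPocket

end Summit.Ventures.PercRepro2
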